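import Mathlib
import HarnessLib
import Summits.AtomisticToContinuum.FouriersLaw.Theses.JunctionLocality
import Literature.MathematicalPhysics.KineticTheory.LangevinChainNESSHolds
import Summits.AtomisticToContinuum.FouriersLaw.Theorems.JunctionLocalitySuperadditiveResistanceStubLinearResponsePlain
import Summits.AtomisticToContinuum.FouriersLaw.Theorems.JunctionLocalitySuperadditiveResistanceStubPlainKuboLink
import Summits.AtomisticToContinuum.FouriersLaw.Theorems.JunctionLocalitySuperadditiveResistanceStubPlainForwardField

/-!
# The crux `SuperadditiveResistance` is an EQUILIBRIUM statement: its hypothesis-free Kubo form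
(crux `JunctionLocality.SuperadditiveResistance`, stmt-AtomisticToContinuum-11748; helper `--supports` it, lead c3 of line
`floating-probe-bypass-laplacian`, 2026-08-16)

The crux quantifies over a weak-NESS uniqueness hypothesis `hU`, a steady-state family `μ`, response coefficients `D` with
their `δ → 0` limits and their positivity. Every one of these is now a THEOREM of the tree at fixed `N`
(`JunctionLocality.NessUnique_holds`, `pinnedChain_exists_isSteadyState`, `finiteResponseOfUnique_proof`,
`positiveConductance_proof`), and the finite-volume Kubo formula `D_L/(L−1) = G_L := γ(1 − (γ/T²)⟨g_L, p_0² − T⟩_{μ_T})`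
along ANY left forward field `g_L` of the plain `L`-chain is landed (`stub_plainKuboLink`). Consequently the crux is
EQUIVALENT to a statement that mentions no steady state at all — the **Kubo insertion bound**

  `∀ ω₂ lam β γ T > 0, ∃ C, ∀ N M ≥ 2, ∀ forward fields g_N, g_M, g_{N+M}: 1/G_N + 1/G_M − C ≤ 1/G_{N+M}`,

superadditivity up to a constant of the equilibrium Kubo RESISTANCE `1/G_L` of the pinned anharmonic chain between two
Langevin baths at temperature `T`. This file proves both directions (`kuboInsertionBound_of_superadditiveResistance`,
`superadditiveResistance_of_kuboInsertionBound`, `superadditiveResistance_iff_kuboInsertionBound`). Use: every line of the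
crux chain (and every refuter) may work with `G_L` only; a refutation of the Kubo form refutes the crux and conversely. The
right-hand side is written out (no definition is introduced). Standard axioms; nothing is taken as a named fact.
-/

noncomputable section

open MeasureTheory Filter Topology
open scoped ContDiff
open Literature.MathematicalPhysics.KineticTheory.HeatConduction

namespace Summit.AtomisticToContinuum.FouriersLaw.Cruxes.SuperadditiveResistance.FloatingProbeBypassLaplacian

/-- **Crux ⇒ Kubo insertion bound.** Feed the crux its own (now proved) hypotheses: weak-NESS uniqueness
(`NessUnique_holds`), the canonical steady-state family chosen from `pinnedChain_exists_isSteadyState` (junk `0` at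
non-positive temperatures), the response coefficients of `finiteResponseOfUnique_proof` and their positivity
(`positiveConductance_proof`); then convert `(L−1)/D_L` into `1/G_L` by the Kubo link `stub_plainKuboLink`. -/
theorem kuboInsertionBound_of_superadditiveResistance
    (h : Summit.AtomisticToContinuum.FouriersLaw.Theses.JunctionLocality.SuperadditiveResistance) :
    ∀ ω₂ lam β γ T : ℝ, 0 < ω₂ → 0 < lam → 0 < β → 0 < γ → 0 < T →
      ∃ C : ℝ, ∀ N M : ℕ, 2 ≤ N → 2 ≤ M →
        ∀ (gN : PhaseSpace N → ℝ) (gM : PhaseSpace M → ℝ) (gL : PhaseSpace (N + M) → ℝ),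
          gN ∈ plainForwardFields ω₂ lam β γ T N → gM ∈ plainForwardFields ω₂ lam β γ T M →
          gL ∈ plainForwardFields ω₂ lam β γ T (N + M) →
          1 / plainKubo ω₂ lam β γ T N gN + 1 / plainKubo ω₂ lam β γ T M gM - C ≤
            1 / plainKubo ω₂ lam β γ T (N + M) gL := by
  intro ω₂ lam β γ T hω hl hβ hγ hT
  classical
  -- (1) weak-NESS uniqueness is a theorem
  have hU := Summit.AtomisticToContinuum.FouriersLaw.Theses.JunctionLocality.NessUnique_holds ω₂ lam β γ hω hl hβ hγ
  -- (2) the canonical steady-state family (existence is a theorem; junk outside positive temperatures)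
  let μ : (N : ℕ) → ℝ → ℝ → Measure (PhaseSpace N) := fun N a b =>
    if hab : 0 < a ∧ 0 < b then
      Classical.choose (pinnedChain_exists_isSteadyState hω hl hβ hγ N hab.1 hab.2)
    else 0
  have hμ : ∀ (N : ℕ) (a b : ℝ), 0 < a → 0 < b →
      (pinnedChain ω₂ lam β γ).IsSteadyState N a b (μ N a b) := by
    intro N a b ha hb
    have hab : 0 < a ∧ 0 < b := ⟨ha, hb⟩
    simp only [μ, dif_pos hab]
    exact Classical.choose_spec (pinnedChain_exists_isSteadyState hω hl hβ hγ N hab.1 hab.2)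
  -- (3) response coefficients exist and are positive (theorems)
  have hDex := ThermaliseThenCutProbeInsertion.finiteResponseOfUnique_proof ω₂ lam β γ hω hl hβ hγ hU μ hμ T hT
  choose D hD using hDex
  have hpos := ThermaliseThenCutProbeInsertion.positiveConductance_proof ω₂ lam β γ hω hl hβ hγ hU μ hμ T hT D hD
  -- (4) the crux along this data
  obtain ⟨C, hC⟩ := h ω₂ lam β γ hω hl hβ hγ hU μ hμ T hT D hD hpos
  refine ⟨C, fun N M hN hM gN gM gL hgN hgM hgL => ?_⟩
  -- (5) Kubo link for the three plain chains
  have kN := stub_plainKuboLink ω₂ lam β γ μ T D hω hl hβ hγ hT hU hμ hD hpos N hN gN hgN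
  have kM := stub_plainKuboLink ω₂ lam β γ μ T D hω hl hβ hγ hT hU hμ hD hpos M hM gM hgM
  have kL := stub_plainKuboLink ω₂ lam β γ μ T D hω hl hβ hγ hT hU hμ hD hpos (N + M) (by omega) gL hgL
  have hcast : ((N + M : ℕ) : ℝ) - 1 = (N : ℝ) + (M : ℝ) - 1 := by push_cast; ring
  rw [hcast] at kL
  have rN : 1 / plainKubo ω₂ lam β γ T N gN = ((N : ℝ) - 1) / D N := by rw [← kN, one_div_div]
  have rM : 1 / plainKubo ω₂ lam β γ T M gM = ((M : ℝ) - 1) / D M := by rw [← kM, one_div_div]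
  have rL : 1 / plainKubo ω₂ lam β γ T (N + M) gL = ((N : ℝ) + (M : ℝ) - 1) / D (N + M) := by
    rw [← kL, one_div_div]
  rw [rN, rM, rL]
  exact hC N M hN hM

/-- **Kubo insertion bound ⇒ crux.** Along the crux's own data (`hU`, `μ`, `D`), left forward fields of the plain
`N`-, `M`-, `(N+M)`-chains exist (`stub_plainForwardField`) and the Kubo link `stub_plainKuboLink` turns `1/G_L` back
into `(L−1)/D_L`. -/
theorem superadditiveResistance_of_kuboInsertionBound
    (hK : ∀ ω₂ lam β γ T : ℝ, 0 < ω₂ → 0 < lam → 0 < β → 0 < γ → 0 < T →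
      ∃ C : ℝ, ∀ N M : ℕ, 2 ≤ N → 2 ≤ M →
        ∀ (gN : PhaseSpace N → ℝ) (gM : PhaseSpace M → ℝ) (gL : PhaseSpace (N + M) → ℝ),
          gN ∈ plainForwardFields ω₂ lam β γ T N → gM ∈ plainForwardFields ω₂ lam β γ T M →
          gL ∈ plainForwardFields ω₂ lam β γ T (N + M) →
          1 / plainKubo ω₂ lam β γ T N gN + 1 / plainKubo ω₂ lam β γ T M gM - C ≤
            1 / plainKubo ω₂ lam β γ T (N + M) gL) :
    Summit.AtomisticToContinuum.FouriersLaw.Theses.JunctionLocality.SuperadditiveResistance := by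
  intro ω₂ lam β γ hω hl hβ hγ hU μ hμ T hT D hD hpos
  obtain ⟨C, hC⟩ := hK ω₂ lam β γ T hω hl hβ hγ hT
  refine ⟨C, fun N M hN hM => ?_⟩
  obtain ⟨gN, hgN⟩ := stub_plainForwardField ω₂ lam β γ T hω hl hβ hγ hT N hN
  obtain ⟨gM, hgM⟩ := stub_plainForwardField ω₂ lam β γ T hω hl hβ hγ hT M hM
  obtain ⟨gL, hgL⟩ := stub_plainForwardField ω₂ lam β γ T hω hl hβ hγ hT (N + M) (by omega)
  have kN := stub_plainKuboLink ω₂ lam β γ μ T D hω hl hβ hγ hT hU hμ hD hpos N hN gN hgN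
  have kM := stub_plainKuboLink ω₂ lam β γ μ T D hω hl hβ hγ hT hU hμ hD hpos M hM gM hgM
  have kL := stub_plainKuboLink ω₂ lam β γ μ T D hω hl hβ hγ hT hU hμ hD hpos (N + M) (by omega) gL hgL
  have hcast : ((N + M : ℕ) : ℝ) - 1 = (N : ℝ) + (M : ℝ) - 1 := by push_cast; ring
  rw [hcast] at kL
  have rN : ((N : ℝ) - 1) / D N = 1 / plainKubo ω₂ lam β γ T N gN := by rw [← kN, one_div_div]
  have rM : ((M : ℝ) - 1) / D M = 1 / plainKubo ω₂ lam β γ T M gM := by rw [← kM, one_div_div]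
  have rL : ((N : ℝ) + (M : ℝ) - 1) / D (N + M) = 1 / plainKubo ω₂ lam β γ T (N + M) gL := by
    rw [← kL, one_div_div]
  rw [rN, rM, rL]
  exact hC N M hN hM gN gM gL hgN hgM hgL

/-- **The crux is equivalent to the Kubo insertion bound** — superadditivity up to a constant of the equilibrium
Kubo resistance `1/G_L`, `G_L = γ(1 − (γ/T²)⟨g_L, p_0² − T⟩_{μ_T})`, of the pinned anharmonic chain between two Langevin
baths at one temperature `T`; no steady state, uniqueness hypothesis or response limit appears on the right. -/
theorem superadditiveResistance_iff_kuboInsertionBound :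
    Summit.AtomisticToContinuum.FouriersLaw.Theses.JunctionLocality.SuperadditiveResistance ↔
      ∀ ω₂ lam β γ T : ℝ, 0 < ω₂ → 0 < lam → 0 < β → 0 < γ → 0 < T →
        ∃ C : ℝ, ∀ N M : ℕ, 2 ≤ N → 2 ≤ M →
          ∀ (gN : PhaseSpace N → ℝ) (gM : PhaseSpace M → ℝ) (gL : PhaseSpace (N + M) → ℝ),
            gN ∈ plainForwardFields ω₂ lam β γ T N → gM ∈ plainForwardFields ω₂ lam β γ T M →
            gL ∈ plainForwardFields ω₂ lam β γ T (N + M) →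
            1 / plainKubo ω₂ lam β γ T N gN + 1 / plainKubo ω₂ lam β γ T M gM - C ≤
              1 / plainKubo ω₂ lam β γ T (N + M) gL :=
  ⟨kuboInsertionBound_of_superadditiveResistance, superadditiveResistance_of_kuboInsertionBound⟩

end Summit.AtomisticToContinuum.FouriersLaw.Cruxes.SuperadditiveResistance.FloatingProbeBypassLaplacian

end
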